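import Summits.QuantumFields.BalabanUV.T4Continuum.Spine.NE3.PairClassAkB8
import Literature.MathematicalPhysics.QuantumFieldTheory.Balaban1983to89.B8Thm4HypothesesPair
import HarnessLib

/-!
# T⁴ programme, node NE3 (pub-ymgap DAG node N16) — [B8] THEOREM 4 (p. 88) APPLIES AT THE MINIMISER PAIR: the tree's typed Theorem-4
# interface `B8Eq119TwistedAxial.Thm4At` (general background; `Reg`, `Restr`, `Concl` abstract — the N05 side) yields its conclusion for
# `(U₀, U) = (W, U_A)`, `W = rescale L (bavg L U_B)`, in the pinned axial pre-gauge, from row NE3's leaf data ALONE: the small-field class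
# and the (H3ˢᵘᵖ) sup-regularity letters of `U_A`, `U_B` — plus «(3.35) of [4]» for `W` (`PairThm4AtB8`)

Cell `pub-ymgap`, HUMAN RULING D-0062, seat `pub-ymgap-dag-n16-b` (FIRST-MISSING-ESTIMATE for N16 = NE3; writer prover-pub-ymgap-dag-n16-b-g0-0,
2026-08-25).  ONE-NAME CAPSTONE of this seat's four files for the knit seat `pub-ymgap-dag-n16-a`: `Literature/…/B8Eq166ConstraintPair` (pinned
axial gauge, (1.65)∕(1.66) at a pair), `Spine/NE3/PairAxialGaugeB8` (its NE3-pair reading), `Literature/…/B8Thm4HypothesesPair` (`Thm4At`'s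
pair-specific binders discharged; `concl_of_thm4At_pair`), `Spine/NE3/PairClassAkB8` ((1.7)+(1.9) = `B8Ineq132.InAk` at the pair from `RegularSup`).

WHAT ([folklore]; one theorem, 0 def, 0 sorry): **`concl_of_thm4At_minimisers`** — for `d ≥ 1`, `L ≥ 2`, `U_A` a run-`k` minimiser and `U_B` a
run-`(k+1)` minimiser over `sfClass d L N ε` with the same datum `V`, `RegularSup d L N b c k U_A`, `RegularSup d L N b c (k+1) U_B` (the (H3ˢᵘᵖ)
letters), the lines `b∕(Lᵏ)² ≤ 1∕4`, (Rb) `2¹⁵(d+1)²(d+4)²L²b ≤ 1`, and ONE letter `α` above the radii (`ε < α`, `b + 226(8(d+1)(d+4))²b² < α`,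
`4(d−1)(c + curConst·b²) < α`) in the Prop. 1∕2 ∕ Lemma 1 regime (`C₀α ≤ ⅓`, `2α ≤ c₂′`, `11d²α ≤ 1∕6`): IF [B8] Theorem 4 holds at the background
`W := rescale L (bavg L U_B)` in the typed form `Thm4At L k (Lᵏ)⁻¹ c₁ (unitaryUnits) a M ρ Reg Restr Concl` with `α + 11d²α ≤ c₁`, and `Reg W`
(«(3.35) of [4]»), THEN there is exactly one unitary `u` with `Restr W u` ((1.29)) and `Concl α (11d²α) W U′ u` ((1.37), (1.38), (1.62) for
`U₁ = U′^{u⁻¹}`), `U′ = U_A^{u₀}·W⁻¹` with `u₀ = ptw L W U_A k` the pinned axial pre-gauge (unitary, periodic, `u₀(Lᵏz) = 1`, constraint kept —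
`PairAxialGaugeB8.exists_pairAxialGauge`).  I.e. the N05 → N16 edge of the DAG BY NAME: what N16 still needs from [B8] is EXACTLY `Thm4At` at a
curved background with concrete `Reg ∕ Restr ∕ Concl` (+ Prop. 3's `grad ∕ holder`, + the `Concl → LandauRepB8Avg` dictionary).
HONEST FRAMING (page 1): a modus ponens; `Thm4At` and `Reg` are HYPOTHESES ([B8] Thm 4 ∕ [B9] (3.35) at a curved background are NOT proved anywhere in
the tree); the (H3ˢᵘᵖ) letters are [B11] Thm 1 TYPE hypotheses; Thm 2 ∕ NE3 NOT proved; spine 0∕9; finite T⁴ rung (B)+1 at fixed ε — NOT infinite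
volume, NOT mass gap, NOT `BetaPertH`, NOT Clay.  PLACEMENT: `Spine/NE3/`.
-/

set_option autoImplicit false

open scoped BigOperators Matrix Matrix.Norms.L2Operator
open NormedSpace

namespace Summit.QuantumFields.BalabanUV.T4Continuum.NE3.PairThm4AtB8

open Literature.MathematicalPhysics.QuantumFieldTheory.Balaban1983to89
open B7Prop1Explicit B7Prop2Explicit
open B8Lemma1NonAbelian (pert)
open B8Ineq132 (InAk)
open B8Eq131Cubes (cube)
open B8Eq119TwistedAxial (Thm4At)
open B8Eq166ConstraintPair (ptw)
open B8Thm4HypothesesPair (concl_of_thm4At_pair)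
open B12Ineq417Flat (shiftCfg)
open T4AveragingDeficitWall (IsUnitaryCfg SmallField)
open T4AveragingDeficitWallBoundary (IsPeriodicCfg)
open MinimalActionSandwich (IsMinimiser)
open MinimalActionRate (Regular sfClass rescale_bavg_mem_sfClass)
open MinimalActionRefine (RegularSup)
open BlockAverageCurrent (curConst curConst_nonneg)
open NE3.PairFrameCondition (avgIter_eq_of_isMinimiser avgIter_rescale_bavg_eq_of_isMinimiser)
open NE3.SupplierB8SfClassPrep (pdev_le_of_smallField)
open NE3.PairClassAkB8 (inAk_pair)

noncomputable section

variable {d : ℕ} {n : Type*} [Fintype n] [DecidableEq n]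

omit [Fintype n] [DecidableEq n] in
/-- `a / t² < α · (t⁻¹)²` for `a < α`, `1 ≤ t`. [folklore] -/
private theorem div_sq_lt {a α t : ℝ} (h : a < α) (ht : 1 ≤ t) : a / t ^ 2 < α * (t⁻¹) ^ 2 := by
  have ht0 : 0 < t := by linarith
  rw [inv_pow, ← div_eq_mul_inv]
  exact div_lt_div_of_pos_right h (by positivity)

/-- **[B8] THEOREM 4 APPLIES AT THE MINIMISER PAIR** (statement in the module docstring). [folklore] -/
theorem concl_of_thm4At_minimisers [Nonempty n] (hd : 1 ≤ d) {L N : ℕ} (hL : 2 ≤ L) {ε b c α : ℝ} {k : ℕ}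
    {V UA UB : Site d → Fin d → (Matrix n n ℂ)ˣ}
    (hA : IsMinimiser d (sfClass d L N ε) L N k V UA) (hB : IsMinimiser d (sfClass d L N ε) L N (k + 1) V UB)
    (hregA : RegularSup d L N b c k UA) (hregB : RegularSup d L N b c (k + 1) UB) (hε : 0 ≤ ε) (hb : 0 ≤ b) (hc : 0 ≤ c)
    (hb4 : b / ((L : ℝ) ^ k) ^ 2 ≤ 1 / 4) (hRb : 2 ^ 15 * ((d : ℝ) + 1) ^ 2 * ((d : ℝ) + 4) ^ 2 * (L : ℝ) ^ 2 * b ≤ 1)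
    (hα : 0 < α) (hεα : ε < α) (hbα : b + 226 * (8 * (d + 1) * (d + 4)) ^ 2 * b ^ 2 < α)
    (hcα : 4 * ((d : ℝ) - 1) * (c + curConst d L * b ^ 2) < α)
    (hα3 : C0 d * α ≤ 1 / 3) (hα2 : 2 * α ≤ c2' d L) (hsmall : 11 * (d : ℝ) ^ 2 * α ≤ 1 / 6)
    {c₁ : ℝ} {a : Site d} {M ρ : ℕ}
    {Reg : (Site d → Fin d → (Matrix n n ℂ)ˣ) → Prop}
    {Restr : (Site d → Fin d → (Matrix n n ℂ)ˣ) → (Site d → (Matrix n n ℂ)ˣ) → Prop}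
    {Concl : ℝ → ℝ → (Site d → Fin d → (Matrix n n ℂ)ˣ) → (Site d → Fin d → (Matrix n n ℂ)ˣ) → (Site d → (Matrix n n ℂ)ˣ) → Prop}
    (hThm4 : Thm4At L k (((L : ℝ) ^ k)⁻¹) c₁ (unitaryUnits (Matrix n n ℂ)) a M ρ Reg Restr Concl)
    (hc₁ : α + 11 * (d : ℝ) ^ 2 * α ≤ c₁) (hReg : Reg (rescale L (bavg L UB))) :
    ∃ u : Site d → (Matrix n n ℂ)ˣ,
      ((∀ x, u x ∈ unitaryUnits (Matrix n n ℂ)) ∧ Restr (rescale L (bavg L UB)) u ∧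
        Concl α (11 * (d : ℝ) ^ 2 * α) (rescale L (bavg L UB))
          (pert (gaugeAct (ptw L (rescale L (bavg L UB)) UA k) UA) (rescale L (bavg L UB))) u) ∧
      ∀ u' : Site d → (Matrix n n ℂ)ˣ, (∀ x, u' x ∈ unitaryUnits (Matrix n n ℂ)) → Restr (rescale L (bavg L UB)) u' →
        Concl α (11 * (d : ℝ) ^ 2 * α) (rescale L (bavg L UB))
          (pert (gaugeAct (ptw L (rescale L (bavg L UB)) UA k) UA) (rescale L (bavg L UB))) u' → u' = u := by
  letI : CStarAlgebra (Matrix n n ℂ) := {}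
  have hL1 : 1 ≤ L := le_trans (by norm_num) hL
  have hL1r : (1 : ℝ) ≤ L := by exact_mod_cast hL1
  have hLk : (1 : ℝ) ≤ (L : ℝ) ^ k := one_le_pow₀ hL1r
  have hG := avgClosed_unitaryUnits d (𝔸 := Matrix n n ℂ) L
  set W : Site d → Fin d → (Matrix n n ℂ)ˣ := rescale L (bavg L UB) with hWdef
  obtain ⟨hAu, -, hAsm⟩ := hA.mem.1
  have hbs : 512 * (d + 1) * (d + 4) * (L : ℝ) ^ 2 * b ≤ 1 := by
    have hd0 : (0 : ℝ) ≤ d := Nat.cast_nonneg d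
    have h1 : (512 : ℝ) * (d + 1) * (d + 4) ≤ 2 ^ 15 * ((d : ℝ) + 1) ^ 2 * ((d : ℝ) + 4) ^ 2 := by nlinarith
    have hL2b : 0 ≤ (L : ℝ) ^ 2 * b := by positivity
    nlinarith
  have hregB' : Regular d L N b (MinimalActionRefine.gradConst d c) (k + 1) UB := hregB.regular
  obtain ⟨hWu, -, hWsm⟩ := rescale_bavg_mem_sfClass hL1 hb hbs le_rfl hregB'
  have hb' : 0 ≤ b + 226 * (8 * (d + 1) * (d + 4)) ^ 2 * b ^ 2 := by positivity
  have h34 : pdev UA < α * (((L : ℝ) ^ k)⁻¹) ^ 2 :=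
    (pdev_le_of_smallField (div_nonneg hε (by positivity)) hAsm).trans_lt (div_sq_lt hεα hLk)
  have h33 : pdev W < α * (((L : ℝ) ^ k)⁻¹) ^ 2 :=
    (pdev_le_of_smallField (div_nonneg hb' (by positivity)) hWsm).trans_lt (div_sq_lt hbα hLk)
  have hpair : avgIter L UA k = avgIter L W k := by
    rw [avgIter_eq_of_isMinimiser hA, hWdef, avgIter_rescale_bavg_eq_of_isMinimiser hB]
  obtain ⟨hAkW, hAkA, -⟩ := inAk_pair hd hL1 hA hB hregA hregB hb hc hb4 hRb hα.le hbα hcα (cube L a M ρ k)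
    (u₀ := fun _ => (1 : (Matrix n n ℂ)ˣ)) (fun _ => (unitaryUnits (Matrix n n ℂ)).one_mem)
  exact concl_of_thm4At_pair L hL hd hG k hThm4 W UA hWu hAu hα hα3 hα2 h33 h34 hpair hsmall hc₁ hAkW hReg hAkA

end

end Summit.QuantumFields.BalabanUV.T4Continuum.NE3.PairThm4AtB8
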